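import Literature.NumberTheory.EllipticCurves.Kato2004.IwasawaCohomologyNumberFieldRestriction
import Literature.NumberTheory.EllipticCurves.SelmerPInftyRestriction
import HarnessLib

/-!
# The LOCALISATION `loc_w̄ : 𝐇¹_{K,Γ}(T_pW_K) → 𝐇¹_loc(T_pW|_{Γ_{ℚ_v}})` of the `K`-level Iwasawa cohomology at the place `w̄ ∣ v`
# of `K` singled out by the chosen embedding `ℚ̄ → ℚ̄_v` when `v` SPLITS in `K` (`K_w̄ = ℚ_v`), and `loc_w̄ ∘ res = loc_v`

Topic `NumberTheory/EllipticCurves`, sub-directory `Kato2004`; third file of the `K`-carrier vocabulary (after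
`IwasawaCohomologyNumberField.lean` = the carrier `IwasawaH1DataOver`, and `…Restriction.lean` = the Shapiro restriction
`resOver`).  Seat `bsd-2adic-conv-1` GEN 29 (cell `pub/bsd-2adic`), WANTED-CARRIER-K of the pen's RC-366 (2) / RC-369: with
`loc_w̄` the Poitou–Tate binder of stub 4″ (`TwoAdicShapiroPT.ShapiroLatticePoitouTateAtTwo`: `L = loc_w̄ H¹_Iw(K_Σ/K, T₂W)
≤ 𝐇¹_loc`) becomes STATABLE over genuine carriers.  HONEST FRAMING: definitions with bodies and proved theorems only; no
named fact, no `sorry`; nothing about any curve is asserted; BSD is not advanced by this file.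

Setting (as in `…Restriction.lean`): `κ : ZpExtension ℚ p`, `h : κ ∘ res_{K/ℚ}` onto, the restricted tower `κ.restrict K h` of `K`;
a finite place `v` of `ℚ` with the tree's chosen embedding `ι_v : ℚ̄ → ℚ̄_v` (`closureEmb`) and the restriction
`res_v = resGalOfEmb ι_v : Γ_{ℚ_v} → Γ_ℚ`, whose image is the decomposition group `D_v` of the prime `𝔓₀` of `ℚ̄` cut out by `ι_v`
(`DecompositionGroupOfCompletion.lean`).  SPLITTING HYPOTHESIS `hD : D_v ≤ galRange K` (= the image of `Γ_K → Γ_ℚ`): `𝔓₀ ∩ K =: w̄`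
is a place of `K` with `K_w̄ = ℚ_v` — for `K/ℚ` Galois this holds iff `v` splits completely in `K` (e.g. `v = 2` split in the imaginary
quadratic `K` of the Greenberg twist).  Under `hD`, `Γ_{ℚ_v} → Γ_ℚ` lifts to **`ψ = localToAbsGal : Γ_{ℚ_v} →ₜ* Γ_K`** (through
`rangeToResGal : galRange K ≅ Γ_K`), `res ∘ ψ = res_v` (`absGaloisRestrict_localToAbsGal`), i.e. `ψ` IS the local Galois group
`Γ_{K_w̄} = Γ_{ℚ_v} → Γ_K` at `w̄`.

* §1 `localToAbsGal`, `layerLocHomOver n : Gal(ℚ̄_v/ℚ_{n,v}) →ₜ* Gal(K̄/K_n)` (`ψ` maps the local layers into the layers of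
  `κ.restrict K h`: `κ.restrict (ψ g) = κ (res_v g)`), `layerLocRepHomOver` (coefficients `θ_∞⁻¹ : T_p(W_K) → T_pW`),
  **`layerLocOver n : H¹(K_n, T_pW_K) → H¹(ℚ_{n,v}, T_pW)`**; `layerLocOver_conjMap`; `layerLocOver_layerCoresOver` (compatible with the
  trace maps when `κ ∘ res_v` is onto — automatic for the cyclotomic `κ` at `v = p`, `surjective_comp_resGalOfEmb_of_isCyclotomic`);
  **`layerLocOver_layerResOver : loc_{w̄,n} ∘ res_n = loc_{v,n}`** (`Kato2004.layerLoc`): `ψ` followed by `res` is `res_v` and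
  `θ_∞⁻¹ ∘ θ_∞ = id`.
* §2 **`IwasawaH1DataOver.locOver IK J … : IK.H →ₗ[Λ] J.H`** into the tree's ℚ-local carrier `J : LocalIwasawaH1Data κ v ((tateRep W p).toLocal v) γᵥ`
  (`proj_locOver`, `locOver_unique`), Λ-linear (`κ.restrict (ψ γᵥ) = κ (res_v γᵥ) = 1 = κ.restrict γK`); **`locOver_resOver :
  locOver ∘ resOver = IwasawaH1Data.loc`** — the Shapiro lattice `L = range locOver` CONTAINS `range loc` (`range_loc_le_range_locOver`).

References: J. Neukirch, A. Schmidt, K. Wingberg, *Cohomology of Number Fields* (2008), I §5 Prop. 1.5.4, (1.5.6) [NeukirchSchmidtWingberg2008];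
K. Kato, Astérisque 295 (2004) §17.13 (17.13.1) (`𝐇¹ → 𝐇¹_loc`) [Kato2004Asterisque]; J. Neukirch, *Algebraic Number Theory* II (9.6)
(`G_w ≅ G(L_w|K_v)`) [NeukirchANT1999]; L. Washington, GTM 83 §13.1 [Washington1997].
-/

noncomputable section

open scoped NumberField Pointwise
open CategoryTheory Field IsDedekindDomain Polynomial
open Literature.NumberTheory.GaloisRepresentations
open Literature.NumberTheory.EllipticCurves (subgroupInclusion subgroupInclusion_apply_coe
  subgroupConj subgroupConj_apply_coe tateModuleEquiv continuous_tateModuleEquiv continuous_tateModuleEquiv_symm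
  tateModuleEquiv_tateGaloisRep_restrict galRange rangeToResGal resGal_rangeToResGal resGal)
open Literature.NumberTheory.EllipticCurves.Kato2004.CM (tateRepK)
open Literature.NumberTheory.EllipticCurves.Kato2004.EulerSystemValues (tateRep)
open Literature.NumberTheory.EllipticCurves.CyclotomicLayer (layerGroup isOpen_layerGroup normal_layerGroup)

namespace Literature.NumberTheory.EllipticCurves.Kato2004

/-! ## §1 The local Galois group at the split place inside `Γ_K`, and the localisation at the `n`-th layer -/

section LayerLoc

variable {K : Type} [Field K] [NumberField K] {p : ℕ} [Fact p.Prime] (κ : ZpExtension ℚ p)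
  (h : Function.Surjective (κ.toContinuousMonoidHom.comp (absGaloisRestrict ℚ K)))
  (v : HeightOneSpectrum (𝓞 ℚ))
  (hD : ∀ g : absoluteGaloisGroup (v.adicCompletion ℚ),
    resGalOfEmb (closureEmb (K := ℚ) (v.adicCompletion ℚ)) g ∈ galRange (K := ℚ) K)

/-- **`ψ : Γ_{ℚ_v} →ₜ* Γ_K`**, the lift of `res_v : Γ_{ℚ_v} → Γ_ℚ` through `Γ_K ≅ galRange K` when the decomposition group `D_v = res_v(Γ_{ℚ_v})`
lies in the image of `Γ_K` (`hD`: the prime of `ℚ̄` cut out by the chosen embedding restricts to a place `w̄` of `K` with `K_w̄ = ℚ_v`).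
[cite: NeukirchANT1999, Ch. II (9.6) (decomposition group = local Galois group)] -/
def localToAbsGal : absoluteGaloisGroup (v.adicCompletion ℚ) →ₜ* absoluteGaloisGroup K :=
  (rangeToResGal (K := ℚ) K).comp
    { toFun := fun g ↦ ⟨resGalOfEmb (closureEmb (K := ℚ) (v.adicCompletion ℚ)) g, hD g⟩
      map_one' := Subtype.ext (map_one _)
      map_mul' := fun _ _ ↦ Subtype.ext (map_mul _ _ _)
      continuous_toFun := (map_continuous _).subtype_mk _ }

/-- `res ∘ ψ = res_v`: `ψ` is a lift of the local restriction. [cite: NeukirchANT1999, Ch. II (9.6)] -/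
@[simp] theorem absGaloisRestrict_localToAbsGal (g : absoluteGaloisGroup (v.adicCompletion ℚ)) :
    absGaloisRestrict ℚ K (localToAbsGal v hD g) = resGalOfEmb (closureEmb (K := ℚ) (v.adicCompletion ℚ)) g := by
  change resGal (K := ℚ) K (rangeToResGal (K := ℚ) K ⟨_, hD g⟩) = _
  exact resGal_rangeToResGal K ⟨_, hD g⟩

/-- `κ.restrict (ψ g) = κ (res_v g)`. [cite: Washington1997, §13.1] -/
theorem restrict_localToAbsGal (g : absoluteGaloisGroup (v.adicCompletion ℚ)) :
    κ.restrict K h (localToAbsGal v hD g) = κ (resGalOfEmb (closureEmb (K := ℚ) (v.adicCompletion ℚ)) g) := by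
  rw [ZpExtension.restrict_apply, absGaloisRestrict_localToAbsGal]

/-- Membership in the local layers through `ψ`: `g ∈ U_n ↔ ψ g ∈ Gal(K̄/K_n)`. [cite: Washington1997, §13.1] -/
theorem mem_layerGroup_iff_localToAbsGal_mem (n : ℕ) (g : absoluteGaloisGroup (v.adicCompletion ℚ)) :
    g ∈ layerGroup κ v n ↔ localToAbsGal v hD g ∈ (κ.restrict K h).layerSubgroup n := by
  rw [Kobayashi2003.mem_localLayerSubgroupOfEmb_iff, ZpExtension.mem_layerSubgroup, restrict_localToAbsGal]

/-- `ψ_n : U_n = Gal(ℚ̄_v/ℚ_{n,v}) →ₜ* Gal(K̄/K_n)`. [cite: NeukirchSchmidtWingberg2008, I §5 Prop. 1.5.4] -/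
def layerLocHomOver (n : ℕ) : layerGroup κ v n →ₜ* (κ.restrict K h).layerSubgroup n where
  toFun g := ⟨localToAbsGal v hD g, (mem_layerGroup_iff_localToAbsGal_mem κ h v hD n g).mp g.2⟩
  map_one' := Subtype.ext (map_one _)
  map_mul' _ _ := Subtype.ext (map_mul _ _ _)
  continuous_toFun := ((map_continuous (localToAbsGal v hD)).comp continuous_subtype_val).subtype_mk _

/-- Unfolding `layerLocHomOver`: `ψ_n g = ψ g` in `Γ_K`. [cite: NeukirchSchmidtWingberg2008, I §5 Prop. 1.5.4 (compatible pairs)] -/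
@[simp] theorem layerLocHomOver_apply_coe (n : ℕ) (g : layerGroup κ v n) :
    ((layerLocHomOver κ h v hD n g : (κ.restrict K h).layerSubgroup n) : absoluteGaloisGroup K) = localToAbsGal v hD g := rfl

variable (W : WeierstrassCurve ℚ) [W.IsElliptic] [ContinuousSMul ℤ_[p] (W.tateModule p)]
  [ContinuousSMul ℤ_[p] ((W.baseChange K).tateModule p)]

/-- The equivariance of `θ_∞⁻¹` along `ψ`: `θ_∞⁻¹ (T_p(W_K)(ψ g) b) = T_pW(res_v g) (θ_∞⁻¹ b)` (from `tateModuleEquiv_tateGaloisRep_restrict` and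
`res ∘ ψ = res_v`). [cite: SilvermanAEC2009, III.§7 and VII.§4 (T_ℓ(E) as a module for the decomposition group)] -/
theorem tateModuleEquiv_symm_toTopRep_ρ (g : absoluteGaloisGroup (v.adicCompletion ℚ)) (b : (W.baseChange K).tateModule p) :
    (tateModuleEquiv W K p).symm ((tateRepK (W.baseChange K) p).toTopRep.ρ (localToAbsGal v hD g) b) =
      ((tateRep W p).toLocal v).toTopRep.ρ g ((tateModuleEquiv W K p).symm b) := by
  apply (tateModuleEquiv W K p).injective
  rw [LinearEquiv.apply_symm_apply]
  change _ = tateModuleEquiv W K p ((tateRep W p).toTopRep.ρ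
    (resGalOfEmb (closureEmb (K := ℚ) (v.adicCompletion ℚ)) g) ((tateModuleEquiv W K p).symm b))
  rw [← absGaloisRestrict_localToAbsGal v hD g, tateModuleEquiv_toTopRep_ρ, LinearEquiv.apply_symm_apply]

/-- The module half: `T_p(W_K)|_{Γ_{K_n}}` pulled back along `ψ_n` maps to `T_pW|_{U_n}` by `θ_∞⁻¹`. [cite: NeukirchSchmidtWingberg2008, I §5 Prop. 1.5.4] -/
def layerLocRepHomOver (n : ℕ) :
    TopRep.res (layerLocHomOver κ h v hD n : layerGroup κ v n →* (κ.restrict K h).layerSubgroup n)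
        (subgroupRep (tateRepK (W.baseChange K) p).toTopRep ((κ.restrict K h).layerSubgroup n)) ⟶
      subgroupRep ((tateRep W p).toLocal v).toTopRep (layerGroup κ v n) :=
  TopRep.ofHom ⟨⟨(tateModuleEquiv W K p).symm.toLinearMap, continuous_tateModuleEquiv_symm W K p⟩, fun g =>
    ContinuousLinearMap.ext fun b => tateModuleEquiv_symm_toTopRep_ρ v hD W (g : absoluteGaloisGroup (v.adicCompletion ℚ)) b⟩

/-- The coefficient map of `loc_{w̄,n}` is `θ_∞⁻¹`. [cite: NeukirchSchmidtWingberg2008, I §5 Prop. 1.5.4 (compatible pairs)] -/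
@[simp] theorem layerLocRepHomOver_hom_apply (n : ℕ) (b : (W.baseChange K).tateModule p) :
    (layerLocRepHomOver κ h v hD W n).hom b = (tateModuleEquiv W K p).symm b := rfl

/-- **Localisation at the `n`-th layer at the split place**: `loc_{w̄,n} : H¹(K_n, T_pW_K) → H¹(ℚ_{n,v}, T_pW)` (`K_{n,w̄} = ℚ_{n,v}`).
[cite: Kato2004Asterisque, §17.13 (17.13.1) (p. 279)] [cite: NeukirchSchmidtWingberg2008, I §5 Prop. 1.5.4] -/
def layerLocOver (n : ℕ) :
    H1 (tateRepK (W.baseChange K) p) ((κ.restrict K h).layerSubgroup n) ⟶ H1 ((tateRep W p).toLocal v) (layerGroup κ v n) :=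
  ContinuousCohomology.map (layerLocHomOver κ h v hD n) (layerLocRepHomOver κ h v hD W n) 1

/-- `loc_{w̄,n}` on explicit cocycles: `[φ] ↦ [θ_∞⁻¹ ∘ φ ∘ ψ_n]`. [cite: SerreGaloisCohomology1997, I §2.4] -/
theorem layerLocOver_oneCocycleClass (n : ℕ)
    (φ : contOneCocycles (subgroupRep (tateRepK (W.baseChange K) p).toTopRep ((κ.restrict K h).layerSubgroup n))) :
    layerLocOver κ h v hD W n (oneCocycleClass _ φ) =
      oneCocycleClass _ (contOneCocycles.pullback (layerLocHomOver κ h v hD n) (layerLocRepHomOver κ h v hD W n) φ) :=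
  map_oneCocycleClass _ _ _ φ

/-- **`loc_{w̄,n}` is `Γ_{ℚ_v}`-equivariant**: `loc_{w̄,n} (ψ g · y) = g · loc_{w̄,n} y`. [cite: NeukirchSchmidtWingberg2008, I §5 Prop. 1.5.4] -/
theorem layerLocOver_conjMap (n : ℕ) (g : absoluteGaloisGroup (v.adicCompletion ℚ))
    (y : H1 (tateRepK (W.baseChange K) p) ((κ.restrict K h).layerSubgroup n)) :
    layerLocOver κ h v hD W n (conjMap (tateRepK (W.baseChange K) p).toTopRep ((κ.restrict K h).layerSubgroup n)
        (localToAbsGal v hD g) 1 y) =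
      (haveI := normal_layerGroup κ v n;
        conjMap ((tateRep W p).toLocal v).toTopRep (layerGroup κ v n) g 1 (layerLocOver κ h v hD W n y)) := by
  haveI := normal_layerGroup κ v n
  obtain ⟨φ, rfl⟩ := oneCocycleClass_surjective _ y
  rw [conjMap_oneCocycleClass, layerLocOver_oneCocycleClass, layerLocOver_oneCocycleClass, conjMap_oneCocycleClass]
  refine congrArg _ (Subtype.ext (ContinuousMap.ext fun x => ?_))
  have harg : layerLocHomOver κ h v hD n (subgroupConj (layerGroup κ v n) g x) =
      subgroupConj ((κ.restrict K h).layerSubgroup n) (localToAbsGal v hD g) (layerLocHomOver κ h v hD n x) :=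
    Subtype.ext (by simp [subgroupConj_apply_coe, layerLocHomOver_apply_coe, map_mul, map_inv])
  rw [contOneCocycles.pullback_apply, conj_pullback_apply, conj_pullback_apply, contOneCocycles.pullback_apply, harg,
    layerLocRepHomOver_hom_apply, layerLocRepHomOver_hom_apply]
  exact tateModuleEquiv_symm_toTopRep_ρ v hD W g _

/-- `ψ_{n+1}` and `ψ_n` agree on `U_{n+1}` (one-sided unfolding). [folklore] -/
private theorem layerLocHomOver_succ_coe (n : ℕ) (x : layerGroup κ v (n + 1)) :
    ((layerLocHomOver κ h v hD (n + 1) x : (κ.restrict K h).layerSubgroup (n + 1)) : absoluteGaloisGroup K) =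
      ((layerLocHomOver κ h v hD n ⟨x, layerGroup_antitone κ v (Nat.le_succ n) x.2⟩ : (κ.restrict K h).layerSubgroup n) :
        absoluteGaloisGroup K) := by
  rw [layerLocHomOver_apply_coe, layerLocHomOver_apply_coe]

/-- The coset condition at the split place: if `κ ∘ res_v` is onto then every `g ∈ Gal(K̄/K_n)` is `ψ(g')` times an element of
`Gal(K̄/K_{n+1})`, for some `g' ∈ U_n`. [cite: Washington1997, §13.1] -/
theorem exists_layerLocHomOver_inv_mul_mem
    (hsurjv : Function.Surjective
      (κ.toContinuousMonoidHom.comp (resGalOfEmb (closureEmb (K := ℚ) (v.adicCompletion ℚ)))))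
    (n : ℕ) (g : (κ.restrict K h).layerSubgroup n) :
    ∃ g' : layerGroup κ v n,
      ((layerLocHomOver κ h v hD n g' : (κ.restrict K h).layerSubgroup n) : absoluteGaloisGroup K)⁻¹ *
          (g : absoluteGaloisGroup K) ∈ (κ.restrict K h).layerSubgroup (n + 1) := by
  obtain ⟨τ, hτ⟩ := hsurjv (κ.restrict K h (g : absoluteGaloisGroup K))
  have hτ' : κ (resGalOfEmb (closureEmb (K := ℚ) (v.adicCompletion ℚ)) τ) = κ.restrict K h (g : absoluteGaloisGroup K) := hτ
  have hτmem : τ ∈ layerGroup κ v n := by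
    rw [Kobayashi2003.mem_localLayerSubgroupOfEmb_iff, hτ']
    exact ZpExtension.mem_layerSubgroup.mp g.2
  refine ⟨⟨τ, hτmem⟩, ?_⟩
  apply (κ.restrict K h).kerSubgroup_le_layerSubgroup (n + 1)
  rw [ZpExtension.mem_kerSubgroup, map_mul, map_inv, layerLocHomOver_apply_coe, restrict_localToAbsGal, hτ', inv_mul_cancel]

/-- **`loc_w̄` commutes with the trace maps**: `loc_{w̄,n} ∘ Cor_{K_{n+1}/K_n} = Cor_{ℚ_{n+1,v}/ℚ_{n,v}} ∘ loc_{w̄,n+1}` when `κ ∘ res_v` is onto.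
[cite: NeukirchSchmidtWingberg2008, I §5 Prop. 1.5.4 and (1.5.6)] -/
theorem layerLocOver_layerCoresOver
    (hsurjv : Function.Surjective
      (κ.toContinuousMonoidHom.comp (resGalOfEmb (closureEmb (K := ℚ) (v.adicCompletion ℚ)))))
    (n : ℕ) (y : H1 (tateRepK (W.baseChange K) p) ((κ.restrict K h).layerSubgroup (n + 1))) :
    layerLocOver κ h v hD W n (layerCoresOver (tateRepK (W.baseChange K) p) (κ.restrict K h) n y) =
      localLayerCores κ v ((tateRep W p).toLocal v) n (layerLocOver κ h v hD W (n + 1) y) := by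
  haveI : CompactSpace (absoluteGaloisGroup K) := absoluteGaloisGroup_compactSpace K
  haveI hfiK : ((κ.restrict K h).layerSubgroup (n + 1)).FiniteIndex :=
    finiteIndex_of_isOpen_of_compactSpace _ ((κ.restrict K h).isOpen_layerSubgroup (n + 1))
  letI i1 : Fintype ((κ.restrict K h).layerSubgroup n ⧸
      ((κ.restrict K h).layerSubgroup (n + 1)).subgroupOf ((κ.restrict K h).layerSubgroup n)) :=
    Fintype.ofFinite _
  letI i2 := localLayerFintypeQuot κ v n (n + 1)
  have hcos : ∀ g : (κ.restrict K h).layerSubgroup n, ∃ g' : layerGroup κ v n,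
      (layerLocHomOver κ h v hD n g')⁻¹ * g ∈
        ((κ.restrict K h).layerSubgroup (n + 1)).subgroupOf ((κ.restrict K h).layerSubgroup n) := fun g ↦ by
    obtain ⟨g', hg'⟩ := exists_layerLocHomOver_inv_mul_mem κ h v hD hsurjv n g
    exact ⟨g', Subgroup.mem_subgroupOf.mpr hg'⟩
  rw [layerCoresOver_eq_coresLe (tateRepK (W.baseChange K) p) (κ.restrict K h) n,
    localLayerCores_eq_coresLe κ v ((tateRep W p).toLocal v) n]
  exact map_coresLe_eq_coresLe_map (tateRepK (W.baseChange K) p).toTopRep ((tateRep W p).toLocal v).toTopRep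
    ((κ.restrict K h).layerSubgroup_antitone (Nat.le_succ n)) ((κ.restrict K h).isOpen_layerSubgroup (n + 1))
    (layerGroup_antitone κ v (Nat.le_succ n)) (isOpen_layerGroup κ v (n + 1))
    (layerLocHomOver κ h v hD n) (layerLocHomOver κ h v hD (n + 1)) (layerLocHomOver_succ_coe κ h v hD n)
    (fun x ↦ by rw [layerLocHomOver_apply_coe]; exact (mem_layerGroup_iff_localToAbsGal_mem κ h v hD (n + 1) _).symm)
    hcos (layerLocRepHomOver κ h v hD W n) (layerLocRepHomOver κ h v hD W (n + 1))
    (fun m ↦ by rw [layerLocRepHomOver_hom_apply, layerLocRepHomOver_hom_apply]) y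

/-- **`loc_{w̄,n} ∘ res_n = loc_{v,n}`**: restricting from `ℚ_n` to `K_n` and then localising at the split place `w̄` IS the
localisation at `v` of the `ℚ`-side (`Kato2004.layerLoc`) — on cocycles `θ_∞⁻¹(θ_∞(φ(res(ψ g)))) = φ(res_v g)`.
[cite: Kato2004Asterisque, §17.13 (17.13.1) (p. 279)] -/
theorem layerLocOver_layerResOver (n : ℕ) (y : H1 (tateRep W p) (κ.layerSubgroup n)) :
    layerLocOver κ h v hD W n (layerResOver κ h W n y) = layerLoc (tateRep W p) κ v n y := by
  obtain ⟨φ, rfl⟩ := oneCocycleClass_surjective _ y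
  rw [layerResOver_oneCocycleClass, layerLocOver_oneCocycleClass, layerLoc_oneCocycleClass]
  refine congrArg _ (Subtype.ext (ContinuousMap.ext fun g => ?_))
  have harg : layerResHom κ h n (layerLocHomOver κ h v hD n g) = layerRes κ v n g :=
    Subtype.ext (by rw [layerResHom_apply_coe, layerLocHomOver_apply_coe, absGaloisRestrict_localToAbsGal,
      resGalSubgroupOfEmb_apply_coe])
  rw [contOneCocycles.pullback_apply, contOneCocycles.pullback_apply, contOneCocycles.pullback_apply,
    layerLocRepHomOver_hom_apply, layerResRepHom_hom_apply, LinearEquiv.symm_apply_apply, harg]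
  rfl

end LayerLoc

/-! ## §2 The localisation `loc_w̄ : 𝐇¹_{K,Γ}(T_pW_K) → 𝐇¹_loc(T_pW|_{Γ_{ℚ_v}})` on the pinned carriers, and `loc_w̄ ∘ res = loc_v` -/

section Loc

variable {K : Type} [Field K] [NumberField K] {p : ℕ} [Fact p.Prime] {κ : ZpExtension ℚ p}
  {h : Function.Surjective (κ.toContinuousMonoidHom.comp (absGaloisRestrict ℚ K))}
  {v : HeightOneSpectrum (𝓞 ℚ)}
  {hD : ∀ g : absoluteGaloisGroup (v.adicCompletion ℚ),
    resGalOfEmb (closureEmb (K := ℚ) (v.adicCompletion ℚ)) g ∈ galRange (K := ℚ) K}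
  {W : WeierstrassCurve ℚ} [W.IsElliptic] [ContinuousSMul ℤ_[p] (W.tateModule p)]
  [ContinuousSMul ℤ_[p] ((W.baseChange K).tateModule p)]
  {γK : absoluteGaloisGroup K} {γᵥ : absoluteGaloisGroup (v.adicCompletion ℚ)}
  (IK : IwasawaH1DataOver (W.baseChange K) p (κ.restrict K h) γK)
  (J : LocalIwasawaH1Data κ v ((tateRep W p).toLocal v) γᵥ)

/-- A linear map intertwining two endomorphisms intertwines the polynomials in them. [folklore] -/
private theorem map_aeval_apply_of_comp_eq_loc {N₁ N₂ : Type*} [AddCommGroup N₁] [Module ℤ_[p] N₁]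
    [AddCommGroup N₂] [Module ℤ_[p] N₂] (g : N₁ →ₗ[ℤ_[p]] N₂) (a : Module.End ℤ_[p] N₁) (b : Module.End ℤ_[p] N₂)
    (hg : g ∘ₗ a = b ∘ₗ g) (r : ℤ_[p][X]) (m : N₁) : g (aeval a r m) = aeval b r (g m) := by
  induction r using Polynomial.induction_on generalizing m with
  | C c => simp
  | add f₁ f₂ h₁ h₂ => simp [h₁, h₂]
  | monomial k c hk =>
    have hc : ∀ m, g (a m) = b (g m) := fun m => by simpa using LinearMap.congr_fun hg m
    rw [pow_succ, ← mul_assoc]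
    conv_rhs => rw [map_mul, Module.End.mul_apply, aeval_X]
    conv_lhs => rw [map_mul, Module.End.mul_apply, aeval_X]
    rw [hk, hc]

namespace IwasawaH1DataOver

/-- The levelwise localisations at the split place of an element of `𝐇¹_{K,Γ}`: `(loc_{w̄,n} (proj n x))_n`. [cite: Kato2004Asterisque, §17.13 (17.13.1)] -/
def locFamilyOver (IK : IwasawaH1DataOver (W.baseChange K) p (κ.restrict K h) γK)
    (hD : ∀ g : absoluteGaloisGroup (v.adicCompletion ℚ),
      resGalOfEmb (closureEmb (K := ℚ) (v.adicCompletion ℚ)) g ∈ galRange (K := ℚ) K)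
    (x : IK.H) : ∀ n : ℕ, H1 ((tateRep W p).toLocal v) (layerGroup κ v n) :=
  fun n ↦ layerLocOver κ h v hD W n (IK.proj n x)

/-- Unfolding `locFamilyOver`. [cite: Kato2004Asterisque, §17.13 (17.13.1) (p. 279)] -/
@[simp] theorem locFamilyOver_apply
    (hD : ∀ g : absoluteGaloisGroup (v.adicCompletion ℚ),
      resGalOfEmb (closureEmb (K := ℚ) (v.adicCompletion ℚ)) g ∈ galRange (K := ℚ) K)
    (x : IK.H) (n : ℕ) : IK.locFamilyOver hD x n = layerLocOver κ h v hD W n (IK.proj n x) := rfl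

/-- The levelwise localisations of `x ∈ 𝐇¹_{K,Γ}` form a norm-compatible LOCAL family when `κ ∘ res_v` is onto. [cite: Kato2004Asterisque, §17.13 (17.13.1)] -/
theorem isLocalNormCompatible_locFamilyOver
    (hD : ∀ g : absoluteGaloisGroup (v.adicCompletion ℚ),
      resGalOfEmb (closureEmb (K := ℚ) (v.adicCompletion ℚ)) g ∈ galRange (K := ℚ) K)
    (hsurjv : Function.Surjective
      (κ.toContinuousMonoidHom.comp (resGalOfEmb (closureEmb (K := ℚ) (v.adicCompletion ℚ)))))
    (x : IK.H) : IsLocalNormCompatible κ v ((tateRep W p).toLocal v) (IK.locFamilyOver hD x) := fun n ↦ by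
  rw [locFamilyOver_apply, locFamilyOver_apply, ← layerLocOver_layerCoresOver κ h v hD W hsurjv, IK.cores_proj]

/-- `(ψ γᵥ)⁻¹ γK ∈ Gal(K̄/K_n)` for all `n` when `res_v γᵥ` and `γK` are topological generators of `κ` and of `κ.restrict K h`
(`κ.restrict (ψ γᵥ) = κ (res_v γᵥ) = 1 = κ.restrict γK`). [cite: Washington1997, §13.1] -/
theorem inv_mul_mem_layerSubgroup_localToAbsGal (hγK : (κ.restrict K h).IsTopGenerator γK)
    (hγᵥ : κ.IsTopGenerator (resGalOfEmb (closureEmb (K := ℚ) (v.adicCompletion ℚ)) γᵥ)) (n : ℕ) :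
    (localToAbsGal v hD γᵥ)⁻¹ * γK ∈ (κ.restrict K h).layerSubgroup n := by
  apply (κ.restrict K h).kerSubgroup_le_layerSubgroup n
  have h1 : κ.restrict K h (localToAbsGal v hD γᵥ) = κ.restrict K h γK := by
    rw [restrict_localToAbsGal, show κ.restrict K h γK = Multiplicative.ofAdd 1 from hγK]; exact hγᵥ
  rw [ZpExtension.mem_kerSubgroup, map_mul, map_inv, h1, inv_mul_cancel]

/-- `loc_{w̄,n}` intertwines the level operators: `loc_{w̄,n} ∘ (conj_{γK} − 1) = (conj_{γᵥ} − 1) ∘ loc_{w̄,n}`.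
[cite: NeukirchSchmidtWingberg2008, I §5 Prop. 1.5.4] -/
theorem layerLocOver_comp_conj_sub_one (hγK : (κ.restrict K h).IsTopGenerator γK)
    (hγᵥ : κ.IsTopGenerator (resGalOfEmb (closureEmb (K := ℚ) (v.adicCompletion ℚ)) γᵥ)) (n : ℕ) :
    (layerLocOver κ h v hD W n).hom.toLinearMap ∘ₗ
        ((conjMap (tateRepK (W.baseChange K) p).toTopRep ((κ.restrict K h).layerSubgroup n) γK 1).hom.toLinearMap - 1) =
      ((localLayerConj κ v ((tateRep W p).toLocal v) n γᵥ).hom.toLinearMap - 1) ∘ₗ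
        (layerLocOver κ h v hD W n).hom.toLinearMap := by
  refine LinearMap.ext fun y ↦ ?_
  simp only [LinearMap.coe_comp, Function.comp_apply, LinearMap.sub_apply, Module.End.one_apply, map_sub]
  rw [localLayerConj_eq]
  change layerLocOver κ h v hD W n (conjMap (tateRepK (W.baseChange K) p).toTopRep
    ((κ.restrict K h).layerSubgroup n) γK 1 y) - _ = _
  rw [conjMap_apply_one_eq_of_inv_mul_mem (tateRepK (W.baseChange K) p).toTopRep ((κ.restrict K h).layerSubgroup n)
      (inv_mul_mem_layerSubgroup_localToAbsGal (hD := hD) hγK hγᵥ n), layerLocOver_conjMap κ h v hD W n]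
  rfl

/-- **The localisation at the split place `loc_w̄ : 𝐇¹_{K,Γ}(T_pW_K) → 𝐇¹_loc(T_pW|_{Γ_{ℚ_v}})`** into the tree's ℚ-local carrier
`J` (`K_{∞,w̄} = ℚ_{∞,v}`), under: `hD` (`v` split, see the module docstring), `hsurjv` (`κ ∘ res_v` onto — automatic at `v = p` for the
cyclotomic `κ`), `hγK`, `hγᵥ` (normalised topological generators): the unique map with `J.proj n (loc_w̄ x) = loc_{w̄,n} (IK.proj n x)`
(`proj_locOver`, `locOver_unique`).  `Λ`-LINEAR (both actions levelwise through `Λ/(ω_n)`; `loc_{w̄,n}` intertwines the level operators).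
[cite: Kato2004Asterisque, §17.13 (17.13.1) (p. 279)] [cite: NeukirchSchmidtWingberg2008, I §5 (1.5.6)] -/
def locOver (hD : ∀ g : absoluteGaloisGroup (v.adicCompletion ℚ),
      resGalOfEmb (closureEmb (K := ℚ) (v.adicCompletion ℚ)) g ∈ galRange (K := ℚ) K)
    (hsurjv : Function.Surjective
      (κ.toContinuousMonoidHom.comp (resGalOfEmb (closureEmb (K := ℚ) (v.adicCompletion ℚ)))))
    (hγK : (κ.restrict K h).IsTopGenerator γK)
    (hγᵥ : κ.IsTopGenerator (resGalOfEmb (closureEmb (K := ℚ) (v.adicCompletion ℚ)) γᵥ)) :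
    IK.H →ₗ[IwasawaAlgebra p] J.H where
  toFun x := (J.proj_surjective _ (IK.isLocalNormCompatible_locFamilyOver hD hsurjv x)).choose
  map_add' x x' := J.ext_of_proj fun n ↦ by
    rw [map_add, (J.proj_surjective _ (IK.isLocalNormCompatible_locFamilyOver hD hsurjv (x + x'))).choose_spec,
      (J.proj_surjective _ (IK.isLocalNormCompatible_locFamilyOver hD hsurjv x)).choose_spec,
      (J.proj_surjective _ (IK.isLocalNormCompatible_locFamilyOver hD hsurjv x')).choose_spec,
      locFamilyOver_apply, locFamilyOver_apply, locFamilyOver_apply, map_add, map_add]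
  map_smul' f x := J.ext_of_proj fun n ↦ by
    obtain ⟨r, hr⟩ := IwasawaH1Exists.exists_polynomial_sub_coe_mem_span p n f
    rw [RingHom.id_apply,
      (J.proj_surjective _ (IK.isLocalNormCompatible_locFamilyOver hD hsurjv (f • x))).choose_spec,
      J.proj_smul n hr,
      (J.proj_surjective _ (IK.isLocalNormCompatible_locFamilyOver hD hsurjv x)).choose_spec,
      locFamilyOver_apply, locFamilyOver_apply, IK.proj_smul hγK n hr]
    exact map_aeval_apply_of_comp_eq_loc (layerLocOver κ h v hD W n).hom.toLinearMap _ _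
      (layerLocOver_comp_conj_sub_one hγK hγᵥ n) r (IK.proj n x)

/-- **The defining property of `loc_w̄`**: `J.proj n (loc_w̄ x) = loc_{w̄,n} (IK.proj n x)`. [cite: Kato2004Asterisque, §17.13 (17.13.1)] -/
theorem proj_locOver (hD : ∀ g : absoluteGaloisGroup (v.adicCompletion ℚ),
      resGalOfEmb (closureEmb (K := ℚ) (v.adicCompletion ℚ)) g ∈ galRange (K := ℚ) K)
    (hsurjv : Function.Surjective
      (κ.toContinuousMonoidHom.comp (resGalOfEmb (closureEmb (K := ℚ) (v.adicCompletion ℚ)))))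
    (hγK : (κ.restrict K h).IsTopGenerator γK)
    (hγᵥ : κ.IsTopGenerator (resGalOfEmb (closureEmb (K := ℚ) (v.adicCompletion ℚ)) γᵥ)) (n : ℕ) (x : IK.H) :
    J.proj n (IK.locOver J hD hsurjv hγK hγᵥ x) = layerLocOver κ h v hD W n (IK.proj n x) :=
  (J.proj_surjective _ (IK.isLocalNormCompatible_locFamilyOver hD hsurjv x)).choose_spec n

/-- **Uniqueness of `loc_w̄`**: any map `IK.H → J.H` computed levelwise by the `loc_{w̄,n}` IS `locOver` (`J.proj` is jointly injective).
[cite: Kato2004Asterisque, §17.13 (17.13.1) (p. 279)] -/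
theorem locOver_unique (hD : ∀ g : absoluteGaloisGroup (v.adicCompletion ℚ),
      resGalOfEmb (closureEmb (K := ℚ) (v.adicCompletion ℚ)) g ∈ galRange (K := ℚ) K)
    (hsurjv : Function.Surjective
      (κ.toContinuousMonoidHom.comp (resGalOfEmb (closureEmb (K := ℚ) (v.adicCompletion ℚ)))))
    (hγK : (κ.restrict K h).IsTopGenerator γK)
    (hγᵥ : κ.IsTopGenerator (resGalOfEmb (closureEmb (K := ℚ) (v.adicCompletion ℚ)) γᵥ))
    {f : IK.H → J.H} (hf : ∀ (n : ℕ) (x : IK.H), J.proj n (f x) = layerLocOver κ h v hD W n (IK.proj n x)) :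
    f = IK.locOver J hD hsurjv hγK hγᵥ :=
  funext fun x ↦ J.ext_of_proj fun n ↦ by rw [hf, proj_locOver]

/-- **`loc_w̄ ∘ res = loc_v`** on the pinned carriers: for `I : IwasawaH1Data W p κ γ` (ℚ-side), `IK` (K-side, tower `κ.restrict K h`)
and the ℚ-local carrier `J`, `IK.locOver J (I.resOver IK x) = I.loc J x` — the localisation of Kato's `𝐇¹` at `v` FACTORS through
the `K`-level carrier and its localisation at the split place `w̄` (levelwise `loc_{w̄,n} ∘ res_n = loc_{v,n}`, `layerLocOver_layerResOver`).
Consequently the Shapiro lattice `loc_w̄(𝐇¹_{K,Γ})` contains `loc_v(𝐇¹_Γ)`. [cite: Kato2004Asterisque, §17.13 (17.13.1) (p. 279)] -/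
theorem locOver_resOver {γ : absoluteGaloisGroup ℚ} (I : IwasawaH1Data W p κ γ)
    (hD : ∀ g : absoluteGaloisGroup (v.adicCompletion ℚ),
      resGalOfEmb (closureEmb (K := ℚ) (v.adicCompletion ℚ)) g ∈ galRange (K := ℚ) K)
    (hsurjv : Function.Surjective
      (κ.toContinuousMonoidHom.comp (resGalOfEmb (closureEmb (K := ℚ) (v.adicCompletion ℚ)))))
    (hγ : κ.IsTopGenerator γ) (hγK : (κ.restrict K h).IsTopGenerator γK)
    (hγᵥ : κ.IsTopGenerator (resGalOfEmb (closureEmb (K := ℚ) (v.adicCompletion ℚ)) γᵥ)) (x : I.H) :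
    IK.locOver J hD hsurjv hγK hγᵥ (I.resOver IK hγ hγK x) = I.loc J hsurjv hγ hγᵥ x :=
  J.ext_of_proj fun n ↦ by
    rw [proj_locOver, IwasawaH1Data.proj_resOver, layerLocOver_layerResOver, IwasawaH1Data.proj_loc]

/-- **`range loc_v ≤ range loc_w̄`**: the `λ`-relevant half of the Shapiro-lattice inclusion `range(loc_W) ≤ L := loc_w̄(H¹_Iw(K_Σ/K, T_pW))`
of stub 4″'s `ShapiroKatoGreenbergDatum.range_le` (the `W`-summand). [cite: Kato2004Asterisque, §17.13 (17.13.1) (p. 279)] -/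
theorem range_loc_le_range_locOver {γ : absoluteGaloisGroup ℚ} (I : IwasawaH1Data W p κ γ)
    (hD : ∀ g : absoluteGaloisGroup (v.adicCompletion ℚ),
      resGalOfEmb (closureEmb (K := ℚ) (v.adicCompletion ℚ)) g ∈ galRange (K := ℚ) K)
    (hsurjv : Function.Surjective
      (κ.toContinuousMonoidHom.comp (resGalOfEmb (closureEmb (K := ℚ) (v.adicCompletion ℚ)))))
    (hγ : κ.IsTopGenerator γ) (hγK : (κ.restrict K h).IsTopGenerator γK)
    (hγᵥ : κ.IsTopGenerator (resGalOfEmb (closureEmb (K := ℚ) (v.adicCompletion ℚ)) γᵥ)) :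
    LinearMap.range (I.loc J hsurjv hγ hγᵥ) ≤ LinearMap.range (IK.locOver J hD hsurjv hγK hγᵥ) := by
  rintro _ ⟨x, rfl⟩
  exact ⟨I.resOver IK hγ hγK x, IK.locOver_resOver J I hD hsurjv hγ hγK hγᵥ x⟩

end IwasawaH1DataOver

end Loc

end Literature.NumberTheory.EllipticCurves.Kato2004

end
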